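import Summits.BirchSwinnertonDyer.BirchSwinnertonDyer.Theorems.CMKolyvaginAtInertTwoLowerLevelTwoGenusPlaceAtTwo
import Summits.BirchSwinnertonDyer.BirchSwinnertonDyer.Theorems.CMKolyvaginAtInertTwoGenusTrivialitySelmerAtTwo
import Summits.BirchSwinnertonDyer.BirchSwinnertonDyer.Theorems.GenusKolyvaginAtTwoShaCardDvdPowAtTwoRDefectPrimes
import Literature.NumberTheory.EllipticCurves.QuadraticTwistTamagawaI0starExactProofs
import HarnessLib

/-!
# Route `CMKolyvaginAtInertTwo`, crux `CMKolyvaginExactAtInertTwo` (stmt-BirchSwinnertonDyer-24277), `stub_lower` — W-UP on H₂,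
# FILE W4c″: THE GENUS PLACE OF A COMPOSITE HEEGNER FIELD WITH ONE-BIT DEFECT (`Σ ≤ 1`) — NULL PLACES ARE FREE

Seat `bsd-line-cmk2-p1` g21 (cell `bsd-print-cf2`), `--supports stmt-BirchSwinnertonDyer-24277` (helper; closes nothing).
THEOREMS ONLY (no definition, no named fact, no `sorry`).  BSD is NOT proved by any of this; the crux is not closed here.

WHY.  The level-`2` swap engine of W-UP (g19, files W3b `false_of_levelTwo_engine` / W4b `false_of_levelTwo_engine_deep`) is
stated for ONE genus place `u` with `#H¹(ℚ_u, E[2]) ≤ 4` and the descent plumbing (desc-fin) off `u`; g19 instantiated it only for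
PRIME `|d_K|` (file W4c′).  For a composite odd `d_K` the genus defect of g15/g18,
`Σ = Σ_{q ∣ d_K} ([(Δ/q) = −1] + 2·[(Δ/q) = 1 ∧ a_q even]) = Σ_{q ∣ d_K} log₂ #E(ℚ_q)[2]`,
counts the local obstruction: a prime `q ∣ d_K` with defect `0` is a NULL place — `E(ℚ_q)[2] = 0`, hence
`H¹(ℚ_q, E[2]) = 0` by Tate's local Euler characteristic, so EVERY class is Selmer at `q` and (desc-fin) holds there
vacuously — while a prime with defect `1` is a genus place exactly as in the prime case (`#H¹ = 4`).  Hence on `Σ ≤ 1`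
the engine runs unchanged (g20's RESTATE-24277 option R1′, «widening to Σ ≤ 1 … NOT done»).

* `natCard_twoTorsion_padic_eq_one_of_defect_eq_zero` — `#E(ℚ_q)[2] = 1` at a null place (Kramer's dictionary
  `padicValNat_two_one_add_card_filter_twoTorsion` + the Hensel count `natCard_twoTorsion_padic_eq` + Lagrange);
* `natCard_localH1_two_eq_sq` — `#H¹(ℚ_u, E[2]) = #E(ℚ_q)[2]²` at an odd place (Tate, as in file W4c′);
* `natCard_localH1_two_eq_one_of_defect_eq_zero`, `natCard_localH1_two_le_four_of_defect_le_one`;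
* `mem_selmerLocalKer_two_of_natCard_localH1_eq_one` — at a null place every class is Selmer;
* `facts_of_prime_dvd_discr` — `q ∣ d_K` prime, `d_K` odd, Heegner: `q ≠ 2`, `q ∤ N_E`, `q ∤ Δ_min`;
* **`exists_genusPlace_of_sum_defect_le_one`** — for `K` imaginary quadratic, `d_K` odd, Heegner, `Σ ≤ 1`: a prime `q ∣ d_K` and
  its place `u` with `#H¹(ℚ_u, E[2]) ≤ 4` and (desc-fin) OFF `u` (g20's `hdescfin_of_not_dvd_discr` at `v ∤ d_K`, the null places
  at `v ∣ d_K`, `v ≠ u`) — exactly the two engine inputs of file W4b.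

References: [MilneADT2006] I Thm. 2.8, Prop. 3.8, §6; [Kramer1981] §2 proof of Prop. 3 (p. 125); [MazurRubin2010] Lemma 2.2 (i);
[GrossLMS1991] §1.
-/

set_option autoImplicit false
-- the Theorems namespace of this sub repeats the summit name by design (D-0017 nested layout)
set_option linter.dupNamespace false

noncomputable section

open scoped Classical

open Field NumberField IsDedekindDomain Function WeierstrassCurve Rat.HeightOneSpectrum
open Literature.NumberTheory.EllipticCurves
open Literature.NumberTheory.GaloisRepresentations
open Literature.NumberTheory.GaloisCohomology
open Summit.BirchSwinnertonDyer.Rank1Residual.X11b.Relaxation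
open Summit.BirchSwinnertonDyer.BirchSwinnertonDyer.Theorems.GenusExact
open Summit.BirchSwinnertonDyer.BirchSwinnertonDyer.Theorems.GenusExact.RelaxedCount
open Summit.BirchSwinnertonDyer.BirchSwinnertonDyer.Theorems.GenusExact.VisiblePairAtTwo (natCast_mem_primesEquiv_symm)

namespace Summit.BirchSwinnertonDyer.BirchSwinnertonDyer.Theorems.KolyvaginLowerTwo

variable (W : WeierstrassCurve ℚ) [W.IsElliptic] [W.IsGloballyMinimal]

/-! ## §1 Local two-torsion at a null place -/

/-- **`#E(ℚ_q)[2] = 1` AT A NULL PLACE.**  `W/ℚ` globally minimal elliptic, `q` an odd prime of good reduction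
(`q ∤ Δ_min`) with defect `[(Δ/q) = −1] + 2·[(Δ/q) = 1 ∧ a_q even] = 0`: then `E(ℚ_q)` has no point of order `2`
(Kramer's dictionary `ord₂ #Ẽ(𝔽_q)[2] = defect`, Hensel `#E(ℚ_q)[2] = #Ẽ(𝔽_q)[2]`, and Lagrange: a group killed by `2`
of odd order is trivial). [cite: Kramer1981, §2 proof of Prop. 3 (p. 125)] [cite: MazurRubin2010, Lemma 2.2 (i)] -/
theorem natCard_twoTorsion_padic_eq_one_of_defect_eq_zero {q : ℕ} [Fact q.Prime] (hq2 : q ≠ 2)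
    (hqΔ : ¬ (q : ℤ) ∣ minimalDiscriminantInt W)
    (hdef : (if jacobiSym W.Δ.num q = -1 then 1 else 0) +
        (if jacobiSym W.Δ.num q = 1 ∧ Even (W.frobeniusTrace q) then 2 else 0) = 0) :
    Nat.card {Q : (W.baseChange ℚ_[q]).toAffine.Point // 2 • Q = 0} = 1 := by
  rw [VisiblePairAtTwo.num_Δ_eq_minimalDiscriminantInt W] at hdef
  -- `ord₂ (1 + ρ) = 0`, `#E(ℚ_q)[2] = ρ + 1`
  have hval := TwistIstar.padicValNat_two_one_add_card_filter_twoTorsion W q hq2 hqΔ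
  rw [hdef] at hval
  have hcard := GenusKolyTwin.natCard_twoTorsion_padic_eq W hq2 hqΔ
  have hbridge : {x : ZMod q | 4 * x ^ 3 + ((integralModelInt W).b₂ : ZMod q) * x ^ 2 +
      2 * ((integralModelInt W).b₄ : ZMod q) * x + ((integralModelInt W).b₆ : ZMod q) = 0}.ncard =
      (Finset.univ.filter fun x : ZMod q ↦ 4 * x ^ 3 + ((integralModelInt W).b₂ : ZMod q) * x ^ 2 +
        2 * ((integralModelInt W).b₄ : ZMod q) * x + ((integralModelInt W).b₆ : ZMod q) = 0).card := by
    rw [← Set.ncard_coe_finset, Finset.coe_filter]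
    simp only [Finset.mem_univ, true_and]
  -- the group `E(ℚ_q)[2]`
  have hgrp : Nat.card {Q : (W.baseChange ℚ_[q]).toAffine.Point // 2 • Q = 0} =
      Nat.card (AddSubgroup.torsionBy (W.baseChange ℚ_[q]).toAffine.Point (2 : ℤ)) := by
    refine Nat.card_congr (Equiv.subtypeEquivRight fun Q ↦ ?_)
    rw [Submodule.mem_toAddSubgroup, Submodule.mem_torsionBy_iff, two_zsmul, two_nsmul]
  have hodd : ¬ 2 ∣ Nat.card (AddSubgroup.torsionBy (W.baseChange ℚ_[q]).toAffine.Point (2 : ℤ)) := by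
    rw [← hgrp, hcard, hbridge, add_comm]
    intro h2
    rcases padicValNat.eq_zero_iff.mp hval with h | h | h
    · norm_num at h
    · omega
    · exact h h2
  rw [hgrp]
  -- Lagrange: every element has order dividing `2` and dividing the odd cardinality
  have key : ∀ t : AddSubgroup.torsionBy (W.baseChange ℚ_[q]).toAffine.Point (2 : ℤ), t = 0 := by
    intro t
    have h2t : addOrderOf t ∣ 2 := by
      rw [addOrderOf_dvd_iff_nsmul_eq_zero]
      apply Subtype.ext
      have ht : ((t : _) : (W.baseChange ℚ_[q]).toAffine.Point) ∈
          AddSubgroup.torsionBy (W.baseChange ℚ_[q]).toAffine.Point (2 : ℤ) := t.2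
      rw [Submodule.mem_toAddSubgroup, Submodule.mem_torsionBy_iff, two_zsmul] at ht
      simpa [two_nsmul] using ht
    have hct : addOrderOf t ∣ Nat.card (AddSubgroup.torsionBy (W.baseChange ℚ_[q]).toAffine.Point (2 : ℤ)) :=
      addOrderOf_dvd_natCard t
    have h1 : addOrderOf t = 1 := by
      rcases (Nat.dvd_prime Nat.prime_two).mp h2t with h | h
      · exact h
      · exact absurd (h ▸ hct) hodd
    exact AddMonoid.addOrderOf_eq_one_iff.mp h1
  exact Nat.card_eq_one_iff_unique.mpr ⟨⟨fun a b ↦ by rw [key a, key b]⟩, ⟨0⟩⟩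

/-- **`#E(ℚ_q)[2] ≤ 2` WHEN THE DEFECT IS AT MOST ONE BIT**: defect `1` means `(Δ/q) = −1` (a transposition prime,
`#E(ℚ_q)[2] = 2` by `natCard_twoTorsion_padic_eq_two_of_jacobiSym_eq_neg_one`), defect `0` is the null case.
[cite: Kramer1981, §2 proof of Prop. 3 (p. 125)] [cite: MazurRubin2010, Lemma 2.2 (i)] -/
theorem natCard_twoTorsion_padic_le_two_of_defect_le_one {q : ℕ} [Fact q.Prime] (hq2 : q ≠ 2)
    (hqΔ : ¬ (q : ℤ) ∣ minimalDiscriminantInt W)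
    (hdef : (if jacobiSym W.Δ.num q = -1 then 1 else 0) +
        (if jacobiSym W.Δ.num q = 1 ∧ Even (W.frobeniusTrace q) then 2 else 0) ≤ 1) :
    Nat.card {Q : (W.baseChange ℚ_[q]).toAffine.Point // 2 • Q = 0} ≤ 2 := by
  by_cases hJ : jacobiSym W.Δ.num q = -1
  · have hJ' : jacobiSym (minimalDiscriminantInt W) q = -1 := by rwa [VisiblePairAtTwo.num_Δ_eq_minimalDiscriminantInt W] at hJ
    exact (GenusKolyTwin.natCard_twoTorsion_padic_eq_two_of_jacobiSym_eq_neg_one W hq2 hqΔ hJ').le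
  · have h0 : (if jacobiSym W.Δ.num q = -1 then 1 else 0) +
        (if jacobiSym W.Δ.num q = 1 ∧ Even (W.frobeniusTrace q) then 2 else 0) = 0 := by
      rw [if_neg hJ] at hdef ⊢
      by_cases h2 : jacobiSym W.Δ.num q = 1 ∧ Even (W.frobeniusTrace q)
      · rw [if_pos h2] at hdef; omega
      · rw [if_neg h2]
    exact (natCard_twoTorsion_padic_eq_one_of_defect_eq_zero W hq2 hqΔ h0).le.trans one_le_two

/-! ## §2 `#H¹(ℚ_u, E[2])` at an odd place -/

omit [W.IsGloballyMinimal] in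
/-- **`#H¹(ℚ_u, E[2]) = #E(ℚ_q)[2]²`** at the place `u` of an odd prime `q` (Tate's local Euler characteristic
`#H¹ = (#H⁰ · #(ℤ_q/2))²` with `#(ℤ_q/2) = 1`, transported to `ℚ_[q]`; the computation of file W4c′ with the prime left free).
[cite: MilneADT2006, Ch. I, Thm. 2.8] -/
theorem natCard_localH1_two_eq_sq {q : ℕ} [Fact q.Prime] (hq2 : q ≠ 2) (u : HeightOneSpectrum (𝓞 ℚ))
    (hu : ((primesEquiv u : Nat.Primes) : ℕ) = q) :
    Nat.card (galoisCohomology ((W.torsionGaloisModule ((2 ^ 1 : ℕ) : ℤ)).toLocal (Sum.inr u : Place ℚ)) 1) =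
      Nat.card {Q : (W.baseChange ℚ_[q]).toAffine.Point // 2 • Q = 0} ^ 2 := by
  have hqu : (q : 𝓞 ℚ) ∈ u.asIdeal := by rw [← hu]; exact natCast_natGenerator_mem u
  have h2u : ((2 : ℕ) : 𝓞 ℚ) ∉ u.asIdeal := LocalDualityOrder.two_notMem_of_odd_prime_mem hq2 hqu
  have hpp : IsPrimePow (2 ^ 1) := ⟨2, 1, Nat.prime_two.prime, one_pos, rfl⟩
  have hE : Nat.card (galoisCohomology ((W.torsionGaloisModule ((2 ^ 1 : ℕ) : ℤ)).toLocal (Sum.inr u : Place ℚ)) 1) =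
      (Nat.card (nsmulAddMonoidHom (2 ^ 1) : (W.baseChange (u.adicCompletion ℚ)).toAffine.Point →+ _).ker *
        Nat.card (u.adicCompletionIntegers ℚ ⧸ Ideal.span {((2 ^ 1 : ℕ) : u.adicCompletionIntegers ℚ)})) ^ 2 := by
    haveI : CharZero (u.adicCompletion ℚ) := charZero_adicCompletion u
    exact natCard_galoisCohomology_one_torsion_adicCompletion_eq_sq W u (2 ^ 1) hpp (localEulerPoincareCharacteristic_holds _)
  rw [hE, LocalDualityOrder.natCard_quotient_span_natCast_eq_one u (LocalDualityOrder.natCast_pow_notMem u h2u 1), mul_one,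
    GenusKolyTwistLocal.natCard_ker_nsmul_adicCompletion_eq_padic W u (2 ^ 1)]
  -- transport `primesEquiv u ↦ q` and `2 ^ 1 ↦ 2` along a `subst`-able copy of `hu`
  have aux : ∀ (q' : ℕ) (_ : Fact q'.Prime), ((primesEquiv u : Nat.Primes) : ℕ) = q' →
      haveI := Fact.mk (primesEquiv u).2
      Nat.card {Q : (W.baseChange ℚ_[((primesEquiv u : Nat.Primes) : ℕ)]).toAffine.Point // (2 ^ 1) • Q = 0} =
        Nat.card {Q : (W.baseChange ℚ_[q']).toAffine.Point // 2 • Q = 0} := by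
    intro q' _ hu'
    subst hu'
    exact Nat.card_congr (Equiv.subtypeEquivRight fun Q ↦ by rw [pow_one])
  rw [aux q inferInstance hu]

/-- **`H¹(ℚ_u, E[2]) = 0` AT A NULL PLACE** (`#H¹ = #E(ℚ_q)[2]² = 1`). [cite: MilneADT2006, Ch. I, Thm. 2.8]
[cite: Kramer1981, §2 proof of Prop. 3 (p. 125)] -/
theorem natCard_localH1_two_eq_one_of_defect_eq_zero {q : ℕ} [Fact q.Prime] (hq2 : q ≠ 2)
    (hqΔ : ¬ (q : ℤ) ∣ minimalDiscriminantInt W)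
    (hdef : (if jacobiSym W.Δ.num q = -1 then 1 else 0) +
        (if jacobiSym W.Δ.num q = 1 ∧ Even (W.frobeniusTrace q) then 2 else 0) = 0)
    (u : HeightOneSpectrum (𝓞 ℚ)) (hu : ((primesEquiv u : Nat.Primes) : ℕ) = q) :
    Nat.card (galoisCohomology ((W.torsionGaloisModule ((2 ^ 1 : ℕ) : ℤ)).toLocal (Sum.inr u : Place ℚ)) 1) = 1 := by
  rw [natCard_localH1_two_eq_sq W hq2 u hu, natCard_twoTorsion_padic_eq_one_of_defect_eq_zero W hq2 hqΔ hdef, one_pow]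

/-- **`#H¹(ℚ_u, E[2]) ≤ 4` AT A PLACE OF DEFECT AT MOST ONE BIT** (`#H¹ = #E(ℚ_q)[2]² ≤ 2²`): the engine's genus-place
budget, now for any prime of a composite `d_K` with `Σ ≤ 1`. [cite: MilneADT2006, Ch. I, Thm. 2.8] [cite: Kramer1981, Prop. 3] -/
theorem natCard_localH1_two_le_four_of_defect_le_one {q : ℕ} [Fact q.Prime] (hq2 : q ≠ 2)
    (hqΔ : ¬ (q : ℤ) ∣ minimalDiscriminantInt W)
    (hdef : (if jacobiSym W.Δ.num q = -1 then 1 else 0) +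
        (if jacobiSym W.Δ.num q = 1 ∧ Even (W.frobeniusTrace q) then 2 else 0) ≤ 1)
    (u : HeightOneSpectrum (𝓞 ℚ)) (hu : ((primesEquiv u : Nat.Primes) : ℕ) = q) :
    Nat.card (galoisCohomology ((W.torsionGaloisModule ((2 ^ 1 : ℕ) : ℤ)).toLocal (Sum.inr u : Place ℚ)) 1) ≤ 4 := by
  rw [natCard_localH1_two_eq_sq W hq2 u hu]
  have h := natCard_twoTorsion_padic_le_two_of_defect_le_one W hq2 hqΔ hdef
  calc Nat.card {Q : (W.baseChange ℚ_[q]).toAffine.Point // 2 • Q = 0} ^ 2 ≤ 2 ^ 2 := Nat.pow_le_pow_left h 2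
    _ = 4 := by norm_num

/-! ## §3 At a null place every class is Selmer -/

omit [W.IsElliptic] [W.IsGloballyMinimal] in
/-- **At a place with `H¹(ℚ_u, E[2]) = 0` every class of `H¹(ℚ, E[2])` satisfies the Selmer local condition** (its
localisation vanishes, and `0 ∈ 𝓛_u`; bridge `res_mem_kummerLocalConditionAt_iff`). [cite: MilneADT2006, Ch. I, §6 (6.14)] -/
theorem mem_selmerLocalKer_two_of_natCard_localH1_eq_one (u : HeightOneSpectrum (𝓞 ℚ))
    (h1 : Nat.card (galoisCohomology ((W.torsionGaloisModule ((2 ^ 1 : ℕ) : ℤ)).toLocal (Sum.inr u : Place ℚ)) 1) = 1)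
    (ξ : galH1Torsion W ((2 ^ 1 : ℕ) : ℤ)) :
    ξ ∈ selmerLocalKer W (u.adicCompletion ℚ) ((2 ^ 1 : ℕ) : ℤ) := by
  have h0 : galoisCohomology.localization (W.torsionGaloisModule ((2 ^ 1 : ℕ) : ℤ)) (Sum.inr u : Place ℚ) 1 ξ = 0 :=
    haveI := (Nat.card_eq_one_iff_unique.mp h1).1; Subsingleton.elim _ _
  have hres : galoisCohomology.res (W.torsionGaloisModule ((2 ^ 1 : ℕ) : ℤ)) (Place.Completion (Sum.inr u : Place ℚ)) 1 ξ ∈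
      W.kummerLocalConditionAt ((2 ^ 1 : ℕ) : ℤ) (Place.Completion (Sum.inr u : Place ℚ)) := by
    have h0' : galoisCohomology.res (W.torsionGaloisModule ((2 ^ 1 : ℕ) : ℤ))
        (Place.Completion (Sum.inr u : Place ℚ)) 1 ξ = 0 := h0
    rw [h0']
    exact zero_mem _
  exact (res_mem_kummerLocalConditionAt_iff W ((2 ^ 1 : ℕ) : ℤ) (Place.Completion (Sum.inr u : Place ℚ)) ξ).mp hres

/-! ## §4 The genus place of a Heegner field with `Σ ≤ 1` -/

variable {K : Type} [Field K] [NumberField K]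

/-- **A prime of `d_K`** (`d_K` odd, `K` Heegner for `N_E`): `q ≠ 2`, `q ∤ N_E` (primes of `N_E` split, primes of `d_K`
ramify), hence `q ∤ Δ_min(W)` (gk2-p5's `prime_discr_facts` with `d_K = −q` relaxed to `q ∣ d_K`). [cite: GrossLMS1991, §1 (p. 235)] -/
theorem facts_of_prime_dvd_discr (hK : IsImaginaryQuadratic K) (hodd : Odd (NumberField.discr K))
    (hH : SatisfiesHeegnerHypothesis (W.conductorNorm ℤ) K) {q : ℕ} (hq : q.Prime) (hqd : (q : ℤ) ∣ NumberField.discr K) :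
    q ≠ 2 ∧ ¬ q ∣ W.conductorNorm ℤ ∧ ¬ (q : ℤ) ∣ minimalDiscriminantInt W := by
  have hq2 : q ≠ 2 := by
    rintro rfl
    exact (Int.not_even_iff_odd.mpr hodd) (even_iff_two_dvd.mpr (by exact_mod_cast hqd))
  have hqN : ¬ q ∣ W.conductorNorm ℤ := fun hqN ↦ Literature.SatisfiesHeegnerHypothesis.not_dvd_discr hK.1 hH hq hqN hqd
  exact ⟨hq2, hqN, fun hqΔ ↦ hqN (GenusKolyTwin.dvd_conductorNorm_of_dvd_minimalDiscriminantInt W hq hqΔ)⟩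

/-- **THE GENUS PLACE OF A HEEGNER FIELD WITH ONE-BIT DEFECT.**  `W/ℚ` globally minimal elliptic; `K` imaginary quadratic
with `d_K` odd, Heegner for `N_E`, and genus defect `Σ = Σ_{q ∣ d_K} ([(Δ/q) = −1] + 2·[(Δ/q) = 1 ∧ a_q even]) ≤ 1`.  THEN there
is a prime `q ∣ d_K` with its place `u` of `ℚ` such that `#H¹(ℚ_u, E[2]) ≤ 4` and the descent plumbing (desc-fin) holds at
EVERY finite `v ≠ u`: at `v ∤ d_K` by g20's `hdescfin_of_not_dvd_discr` (Milne I.3.8 at good unramified `v`, the Heegner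
splitting at bad `v`), at `v ∣ d_K`, `v ≠ u` because `v` is a null place (`H¹(ℚ_v, E[2]) = 0`).  These are the two genus-place
inputs of the level-`2` engine `false_of_levelTwo_engine_deep` (file W4b), so far supplied only for prime `|d_K|` (file W4c′).
[cite: MilneADT2006, Ch. I Thm. 2.8, Prop. 3.8 and §6] [cite: Kramer1981, Prop. 3] [cite: GrossLMS1991, §1] -/
theorem exists_genusPlace_of_sum_defect_le_one (hK : IsImaginaryQuadratic K) (hodd : Odd (NumberField.discr K))
    (hH : SatisfiesHeegnerHypothesis (W.conductorNorm ℤ) K)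
    (hdef : ∑ q ∈ (NumberField.discr K).natAbs.primeFactors,
        ((if jacobiSym W.Δ.num q = -1 then 1 else 0) +
          (if jacobiSym W.Δ.num q = 1 ∧ Even (W.frobeniusTrace q) then 2 else 0)) ≤ 1) :
    ∃ (q : ℕ) (u : HeightOneSpectrum (𝓞 ℚ)), q.Prime ∧ (q : ℤ) ∣ NumberField.discr K ∧
      ((primesEquiv u : Nat.Primes) : ℕ) = q ∧
      Nat.card (galoisCohomology ((W.torsionGaloisModule ((2 ^ 1 : ℕ) : ℤ)).toLocal (Sum.inr u : Place ℚ)) 1) ≤ 4 ∧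
      ∀ (ξ : galH1Torsion W ((2 ^ 1 : ℕ) : ℤ)) (v : HeightOneSpectrum (𝓞 ℚ)), v ≠ u →
        (∀ w : HeightOneSpectrum (𝓞 K), w.under (𝓞 ℚ) = v →
          resTorsion W K ((2 ^ 1 : ℕ) : ℤ) ξ ∈ selmerLocalKer (W.baseChange K) (w.adicCompletion K) ((2 ^ 1 : ℕ) : ℤ)) →
        ξ ∈ selmerLocalKer W (v.adicCompletion ℚ) ((2 ^ 1 : ℕ) : ℤ) := by
  -- the defect function and the set of primes of `d_K`
  set δ : ℕ → ℕ := fun q ↦ (if jacobiSym W.Δ.num q = -1 then 1 else 0) +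
    (if jacobiSym W.Δ.num q = 1 ∧ Even (W.frobeniusTrace q) then 2 else 0) with hδ_def
  set pf : Finset ℕ := (NumberField.discr K).natAbs.primeFactors with hpf_def
  have hdef' : ∑ q ∈ pf, δ q ≤ 1 := hdef
  have hmem : ∀ {q : ℕ}, q ∈ pf ↔ q.Prime ∧ (q : ℤ) ∣ NumberField.discr K := fun {q} ↦ by
    rw [hpf_def, Nat.mem_primeFactors, Int.natCast_dvd]
    exact ⟨fun h ↦ ⟨h.1, h.2.1⟩, fun h ↦ ⟨h.1, h.2, Int.natAbs_ne_zero.mpr (NumberField.discr_ne_zero K)⟩⟩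
  -- ### choice of the genus prime `q₀`: the unique prime of positive defect if any, else any prime of `d_K`
  obtain ⟨q₀, hq₀pf, hq₀le, hothers⟩ : ∃ q₀ ∈ pf, δ q₀ ≤ 1 ∧ ∀ v ∈ pf, v ≠ q₀ → δ v = 0 := by
    by_cases hex : ∃ q ∈ pf, δ q ≠ 0
    · obtain ⟨q₀, hq₀, hδq₀⟩ := hex
      have hle : δ q₀ ≤ 1 := (Finset.single_le_sum (fun _ _ ↦ Nat.zero_le _) hq₀).trans hdef'
      refine ⟨q₀, hq₀, hle, fun v hv hvq ↦ ?_⟩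
      have hpair : δ q₀ + δ v ≤ 1 := by
        have hsub : ({q₀, v} : Finset ℕ) ⊆ pf := by
          intro x hx
          rcases Finset.mem_insert.mp hx with rfl | hx
          · exact hq₀
          · rwa [Finset.mem_singleton.mp hx]
        have h := (Finset.sum_le_sum_of_subset hsub).trans hdef'
        rwa [Finset.sum_pair (Ne.symm hvq)] at h
      omega
    · push Not at hex
      have hgt : 2 < |NumberField.discr K| := NumberField.abs_discr_gt_two (by rw [hK.1]; norm_num)
      have hne1 : (NumberField.discr K).natAbs ≠ 1 := by
        intro h
        have : |NumberField.discr K| = 1 := by rw [Int.abs_eq_natAbs, h]; rfl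
        omega
      have hq₀p : (NumberField.discr K).natAbs.minFac.Prime := Nat.minFac_prime hne1
      have hq₀pf : (NumberField.discr K).natAbs.minFac ∈ pf := by
        rw [hpf_def, Nat.mem_primeFactors]
        exact ⟨hq₀p, Nat.minFac_dvd _, Int.natAbs_ne_zero.mpr (NumberField.discr_ne_zero K)⟩
      exact ⟨_, hq₀pf, by rw [hex _ hq₀pf]; exact Nat.zero_le _, fun v hv _ ↦ hex v hv⟩
  obtain ⟨hq₀p, hq₀d⟩ := hmem.mp hq₀pf
  haveI : Fact q₀.Prime := ⟨hq₀p⟩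
  obtain ⟨hq₀2, -, hq₀Δ⟩ := facts_of_prime_dvd_discr W hK hodd hH hq₀p hq₀d
  set u : HeightOneSpectrum (𝓞 ℚ) := primesEquiv.symm ⟨q₀, hq₀p⟩ with hu_def
  have hu : ((primesEquiv u : Nat.Primes) : ℕ) = q₀ := by rw [hu_def, Equiv.apply_symm_apply]
  refine ⟨q₀, u, hq₀p, hq₀d, hu, natCard_localH1_two_le_four_of_defect_le_one W hq₀2 hq₀Δ hq₀le u hu, ?_⟩
  -- ### (desc-fin) off `u`
  intro ξ v hvu hξ
  by_cases hvd : ((primesEquiv v : ℕ) : ℤ) ∣ NumberField.discr K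
  · -- a prime of `d_K` other than `q₀`: a null place
    have hvpf : ((primesEquiv v : Nat.Primes) : ℕ) ∈ pf := hmem.mpr ⟨(primesEquiv v).2, hvd⟩
    have hne : ((primesEquiv v : Nat.Primes) : ℕ) ≠ q₀ := fun h ↦
      hvu (Rank1Residual.P2.RationalDescentPlumbing.eq_of_primesEquiv_eq (h.trans hu.symm))
    have hδ0 : δ (primesEquiv v : ℕ) = 0 := hothers _ hvpf hne
    haveI : Fact (Nat.Prime ((primesEquiv v : Nat.Primes) : ℕ)) := ⟨(primesEquiv v).2⟩
    obtain ⟨hv2, -, hvΔ⟩ := facts_of_prime_dvd_discr W hK hodd hH (primesEquiv v).2 hvd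
    exact mem_selmerLocalKer_two_of_natCard_localH1_eq_one W v
      (natCard_localH1_two_eq_one_of_defect_eq_zero W hv2 hvΔ hδ0 v rfl) ξ
  · exact KolyvaginGenusTwo.hdescfin_of_not_dvd_discr hK hH _ ξ v hvd hξ

end Summit.BirchSwinnertonDyer.BirchSwinnertonDyer.Theorems.KolyvaginLowerTwo

end
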